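/-
Copyright (c) 2026 the pub-hodgecm-mathlib formalisation cell (harness21).  Prover seat hodgecm-mathlib-R90-C10-p08 (g2), SLAB R90-TF, section S1 «Ch. 10∕12 local»;
crux H413 = `stmt-HodgeConjecture-24833`; line (D-1) «B_pos» of U4Keys :182 ∕ (S-RT), card (a′)-R = R-S1-32 (R90-C10-plan (g3)): the `HRa` letter of record of the (8⁺b) leaf.
KERNEL module: THEOREMS ONLY (no definition, no named fact, no `sorry`, no instance, no notation).  2026-09-05.
-/
import Summits.HodgeConjecture.HodgeConjecture.Theorems.R90S1BposRamFibreRows            -- ★ p864618 (R90-C10-p07 (g2)) (6e): the three fibre rows over the sphere-value letters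
import Summits.HodgeConjecture.HodgeConjecture.Theorems.R90S1BposRamShellsVanishRa        -- ★ p864421 (this seat) (a′)-1: odd cut-off shells vanish in the (R-a) ratio; brings ★ (B) p864346
import Summits.HodgeConjecture.HodgeConjecture.Theorems.R90S1BposRamSphereFibreRa         -- ★ p864719 (this seat) (a′)-2: the (R-a) sphere values and the ratio
import Summits.HodgeConjecture.HodgeConjecture.Theorems.R90S1BposRamGaussSphereShallow    -- ★ p864720 (this seat) (G4): shallow levels vanish
import HarnessLib

/-!
# R90-TF S1 «Ch10-local» ∕ U4Keys :182, BRANCH B, POSITIVE DEPTH, TAME RAMIFIED, SUB-BRANCH (R-a) — (a′)-R: THE `HRa` LETTER OF RECORD «EVERY CUT-OFF SHELL VANISHES»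
# «`χ₁ = 1` on the `σ`-fixed units of valuation one ⟹ every even and every odd cut-off shell of the Casselman integrand on `N(L⁺_v)` has integral `0`» [Keys1984 §7 Thm (2)]

Cell `pub/hodgecm-mathlib`, crux H413 = `stmt-HodgeConjecture-24833`, route `HCCMUnconditional`; S1 card (a′)-R (R-S1-32).  THEOREMS ONLY; `--supports stmt-HodgeConjecture-24833
--as helper`, count-neutral; NOT THE PAYER of :182 — this is the (R-a) DISJUNCT `⟨h11z, hwwz⟩` of ★ p864247's `HEram` in the shell currency of ★ (6c)∕(6d)∕(8⁺a).
WHAT.  In the frame of ★ (6d) `evenShells_zero_and_exists_const_oddShells_of_rows` (non-split `hns`, tame ramified `he`, `|2|_w = 1`, `χ₁ h₁ hcontr`, Haar data `μX μY μ`, trace-one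
`c` with `σc = c`, `|c_w| = 1`, `ν + ν = m + 1`) plus the conductor letters at `n = m + 1` (`hcond`, sharp `u₁`), the scaling unit `l` of ★ (6e) and the (R-a) letter `hRa0`
«`χ₁ a = 1` for every `σ`-fixed unit `a` with `|a_{w′}| = 1`»: BOTH the even and the odd cut-off shells `∫_{|z|_w = e^j, |x|_w ≤ e^{j−ν}} F₀ dμ` VANISH.  Assembly (no new analysis):
the rows of ★ (6e) `fibreRows_hi ∕ _mid ∕ _lo` over the sphere letters `hΦdeep ∕ hΦcrit ∕ hΦsh`, discharged by ★ (a′)-2 (`Φdeep := Ē(−δ)·ν(C)`, `Φcrit := −Ē(−δ)·ν(𝔪⁺)` under `hfix`)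
and ★ (G4) (shallow levels); even shells = ★ (B) p864346 with both row values `0`; odd shells = ★ (a′)-1 `setIntegral_oddShell_cutoff_eq_zero_of_fibre_ratio` with its `hAB`
discharged by ★ (a′)-2 `sphere_fix_ratio` + `measureReal_fixedUnits_eq_mul_of_ramified` (PAPER P-ram-1 1fba7ee70e95cdc9 §2 (R-a) = p01 (g3) cross §2).
* **`shellsVanish_of_fixTrivial`** — `(∀ j₀ j, j₀ ≤ j → Even j → ∫_{Sh_j ∩ cut ν} F₀ ∂μ = 0) ∧ (∀ j κ, j = 2κ+1 → ∫_{Sh_j ∩ cut ν} F₀ ∂μ = 0)` (set ∕ integrand bytes = ★ (6d)'s).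
HONEST LABEL.  HC_CM is proved only modulo the 7 printed citations (2 remaining named inputs: hLiu418 = `stmt-HodgeConjecture-24832`, h413 = `stmt-HodgeConjecture-24833`) until rung 0
closes; count-neutral — pays NO socket (:182, (S-RT), (S-W), A2′ OPEN); no printed citation discharged; wild corner (`v ∣ 2`) not addressed.

## References
* [Keys1984] D. Keys, *Principal series representations of special unitary groups over local fields*, Compositio Math. 51 (1984), §4–§5, §7 Theorem (2) p. 126.
* [Rogawski1990] J. D. Rogawski, *Automorphic Representations of Unitary Groups in Three Variables*, Ann. of Math. Stud. 123 (1990), §12.2 (2) p. 173.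
* [WeilBNT1967] A. Weil, *Basic Number Theory* (1967), Ch. II §5.
-/

set_option autoImplicit false
set_option linter.dupNamespace false  -- the mandated namespace has the single-problem summit's repeated segment (`HodgeConjecture.HodgeConjecture`)

noncomputable section

open NumberField IsDedekindDomain MeasureTheory Measure Literature.NumberTheory Literature.NumberTheory.Automorphic Literature.NumberTheory.Automorphic.UnitaryGroup
open scoped Matrix MatrixGroups WithZero Valued NNReal ENNReal

namespace Summit.HodgeConjecture.HodgeConjecture.R90.S1.BposRamShellsVanishOfRecord

open Summit.HodgeConjecture.HodgeConjecture.Cruxes.H413 Summit.HodgeConjecture.HodgeConjecture.Cruxes.H413.K2E3BranchBSkewUnitSign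
open Summit.HodgeConjecture.HodgeConjecture.R90.S1.BposRamCutoffShells Summit.HodgeConjecture.HodgeConjecture.R90.S1.BposRamShellsVanishRa
open Summit.HodgeConjecture.HodgeConjecture.R90.S1.BposRamSphereFibreRa Summit.HodgeConjecture.HodgeConjecture.R90.S1.BposRamGaussSphereShallow
open Summit.HodgeConjecture.HodgeConjecture.R90.S1.BposRamFibreRows Summit.HodgeConjecture.HodgeConjecture.R90.S1.BposRamSkewSphereByFixedUnits
open Summit.HodgeConjecture.HodgeConjecture.R90.S1.BposRamFixedUnitsHaar

-- the statement carries the frame-v1 Casselman integrand on the matrix-group carrier of `N(L⁺_v)`: generous budgets (class of ★ p864346)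
set_option synthInstance.maxHeartbeats 400000
set_option maxHeartbeats 6000000

variable (L : Type) [Field L] [NumberField L] [IsCMField L] (v : HeightOneSpectrum (𝓞 ↥(maximalRealSubfield L)))
  (w : PlacesOver L v) (hw : IsCMField.complexConj L • w.1 = w.1)

set_option linter.overlappingInstances false in  -- `[μX.IsAddHaarMeasure] [μX.Regular]`
open scoped Classical in
include hw in
/-- **`HRa` OF RECORD — in the sub-branch (R-a) EVERY cut-off shell vanishes.**  Frame = ★ (6d)'s; letters: conductor at `n = m + 1` (`hcond`, `u₁`), the scaling unit `l` of ★ (6e)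
(`σl = l`, `|l_w| = e⁻²`, `‖l‖ = q⁻²`), trace-one `c` (`σc + c = 1` for ★ (B), `σc = c`, `|c_w| = 1` for ★ (6e) — both hold for `c = ⅟2`), `ν + ν = m + 1`, and `hRa0`.
Assembly: ★ (6e) rows ∘ {★ (a′)-2 values, ★ (G4)} ∘ {★ (B) (even), ★ (a′)-1 (odd, `hAB` by ★ `sphere_fix_ratio`)}. [cite: Keys1984, §7 Theorem (2) p. 126] [cite: Rogawski1990, §12.2 (2) p. 173] -/
theorem shellsVanish_of_fixTrivial (hns : ∀ w' : PlacesOver L v, IsCMField.complexConj L • w'.1 = w'.1)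
    (he : v.asIdeal.ramificationIdx' w.1.asIdeal ≠ 1) (h2w : Valued.v (2 : w.1.adicCompletion L) = 1)
    (χ₁ : (LocalRing L v)ˣ →* ℂˣ) (h₁ : Continuous fun x => ((χ₁ x : ℂˣ) : ℂ))
    (hcontr : ∀ x : (LocalRing L v)ˣ, unitModulusChar (LocalRing L v) x < 1 → ‖((χ₁ x : ℂˣ) : ℂ)‖ < 1)
    [MeasurableSpace (LocalRing L v)] [BorelSpace (LocalRing L v)] (μX : Measure (LocalRing L v)) [μX.IsAddHaarMeasure] [μX.Regular]
    (μY : Measure ↥(HeisRing.skewPart (conjLocal L (IsCMField.complexConj L) v))) [μY.IsAddHaarMeasure] [μY.Regular]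
    [MeasurableSpace ↥(cmBorelTriple L 3 v).N] [BorelSpace ↥(cmBorelTriple L 3 v).N] (μ : Measure ↥(cmBorelTriple L 3 v).N) [μ.IsHaarMeasure]
    {ϖ : w.1.adicCompletion L} (hϖ : Valued.v ϖ = WithZero.exp (-1 : ℤ))
    {c : LocalRing L v} (hc : conjLocal L (IsCMField.complexConj L) v c + c = 1) (hcw : Valued.v (c w) ≤ 1)
    {m ν : ℕ} (hνν : ν + ν = m + 1)
    (hcσ : conjLocal L (IsCMField.complexConj L) v c = c) (hcw1 : Valued.v (c w) = 1) (hm : 1 ≤ m)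
    (hcond : ∀ u : (LocalRing L v)ˣ, (∀ w' : PlacesOver L v, Valued.v (((u : LocalRing L v) w') - 1) ≤ Valued.v ϖ ^ (m + 1)) → χ₁ u = 1)
    (u₁ : (LocalRing L v)ˣ) (hu₁ : ∀ w' : PlacesOver L v, Valued.v (((u₁ : LocalRing L v) w') - 1) ≤ Valued.v ϖ ^ m) (hχu₁ : χ₁ u₁ ≠ 1)
    (l : (LocalRing L v)ˣ) (hlσ : conjLocal L (IsCMField.complexConj L) v (l : LocalRing L v) = l) (hlv : Valued.v ((l : LocalRing L v) w) = WithZero.exp (-2 : ℤ))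
    (hlm : unitModulusChar (LocalRing L v) l = ((Ideal.absNorm v.asIdeal : ℝ≥0) ^ 2)⁻¹)
    (hRa0 : ∀ a : (LocalRing L v)ˣ, Units.map (conjLocal L (IsCMField.complexConj L) v : LocalRing L v →* LocalRing L v) a = a →
      (∀ w' : PlacesOver L v, Valued.v ((a : LocalRing L v) w') = 1) → χ₁ a = 1) :
    (∀ j₀ j : ℕ, j₀ ≤ j → Even j → ∫ n in {m : ↥(cmBorelTriple L 3 v).N |
        Valued.v (((((m : ↥(unitaryGroupOfForm (conjLocal L (IsCMField.complexConj L) v) (cmLocalForm L 3 v))) : GL (Fin 3) (LocalRing L v)) : Matrix (Fin 3) (Fin 3) (LocalRing L v)) 0 2) w) = WithZero.exp (j : ℤ) ∧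
        Valued.v (((((m : ↥(unitaryGroupOfForm (conjLocal L (IsCMField.complexConj L) v) (cmLocalForm L 3 v))) : GL (Fin 3) (LocalRing L v)) : Matrix (Fin 3) (Fin 3) (LocalRing L v)) 0 1) w) ≤ WithZero.exp ((j : ℤ) - ν)},
        (fun n : ↥(cmBorelTriple L 3 v).N =>
          if h : IsUnit ((((n : ↥(unitaryGroupOfForm (conjLocal L (IsCMField.complexConj L) v) (cmLocalForm L 3 v))) : GL (Fin 3) (LocalRing L v)) : Matrix (Fin 3) (Fin 3) (LocalRing L v)) 0 2) then
            ((((χ₁ (Units.map ((conjLocal L (IsCMField.complexConj L) v) : LocalRing L v →* LocalRing L v) h.unit))⁻¹ : ℂˣ) : ℂ) *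
              ((((unitModulusChar (LocalRing L v) h.unit)⁻¹ : ℝ≥0) : ℝ) : ℂ))
          else 0) n ∂μ = 0) ∧
    (∀ j κ : ℕ, j = 2 * κ + 1 → ∫ n in {m : ↥(cmBorelTriple L 3 v).N |
        Valued.v (((((m : ↥(unitaryGroupOfForm (conjLocal L (IsCMField.complexConj L) v) (cmLocalForm L 3 v))) : GL (Fin 3) (LocalRing L v)) : Matrix (Fin 3) (Fin 3) (LocalRing L v)) 0 2) w) = WithZero.exp (j : ℤ) ∧
        Valued.v (((((m : ↥(unitaryGroupOfForm (conjLocal L (IsCMField.complexConj L) v) (cmLocalForm L 3 v))) : GL (Fin 3) (LocalRing L v)) : Matrix (Fin 3) (Fin 3) (LocalRing L v)) 0 1) w) ≤ WithZero.exp ((j : ℤ) - ν)},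
        (fun n : ↥(cmBorelTriple L 3 v).N =>
          if h : IsUnit ((((n : ↥(unitaryGroupOfForm (conjLocal L (IsCMField.complexConj L) v) (cmLocalForm L 3 v))) : GL (Fin 3) (LocalRing L v)) : Matrix (Fin 3) (Fin 3) (LocalRing L v)) 0 2) then
            ((((χ₁ (Units.map ((conjLocal L (IsCMField.complexConj L) v) : LocalRing L v →* LocalRing L v) h.unit))⁻¹ : ℂˣ) : ℂ) *
              ((((unitModulusChar (LocalRing L v) h.unit)⁻¹ : ℝ≥0) : ℝ) : ℂ))
          else 0) n ∂μ = 0) := by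
  haveI : Subsingleton (PlacesOver L v) := PlacesOver.subsingleton_of_smul_eq (IsCMField.complexConj L) (IsCMField.complexConj_ne_one L) w hw
  -- the (R-a) letter in its two spellings
  have hfix : ∀ u : (LocalRing L v)ˣ, (∀ w' : PlacesOver L v, Valued.v ((u : LocalRing L v) w') = 1) →
      conjLocal L (IsCMField.complexConj L) v (u : LocalRing L v) = u → χ₁ u = 1 := fun u hu hσu =>
    hRa0 u (Units.ext (by rw [Units.coe_map, MonoidHom.coe_coe]; exact hσu)) hu
  have hfixP : ∀ u : (LocalRing L v)ˣ, (∀ w' : PlacesOver L v, Valued.v (((u : LocalRing L v) w') - 1) < 1) →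
      conjLocal L (IsCMField.complexConj L) v (u : LocalRing L v) = u → χ₁ u = 1 := fun u hu hσu =>
    hfix u (fun w' => by
      have e : (u : LocalRing L v) w' = 1 + ((u : LocalRing L v) w' - 1) := by ring
      rw [e]; exact Valuation.map_one_add_of_lt _ (hu w')) hσu
  have htriv : ∀ u : (LocalRing L v)ˣ, Valued.v (((u : LocalRing L v) - 1) w) ≤ Valued.v ϖ ^ (m + 1) → χ₁ u = 1 := fun u hu =>
    hcond u (fun w' => by rw [Subsingleton.elim w' w]; exact hu)
  -- a skew unit `δ` with `|δ_w| = e⁻¹` (PART 1) and the (R-a) sphere values of ★ (a′)-2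
  obtain ⟨s₀, hs₀σ, hs₀v⟩ := exists_skew_valued_eq_exp_neg_one L v w hw he h2w
  have hs₀U : IsUnit s₀ := K2E3DepthZeroIwahoriCharacterCM.isUnit_of_apply_ne_zero L v w hw s₀ (fun h => by rw [h, map_zero] at hs₀v; exact WithZero.exp_ne_zero.symm hs₀v)
  set δ : (LocalRing L v)ˣ := hs₀U.unit with hδdef
  have hδ : conjLocal L (IsCMField.complexConj L) v (δ : LocalRing L v) = -(δ : LocalRing L v) := by rw [hδdef, IsUnit.unit_spec]; exact hs₀σ
  have hδv : Valued.v ((δ : LocalRing L v) w) = WithZero.exp (-1 : ℤ) := by rw [hδdef, IsUnit.unit_spec]; exact hs₀v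
  set νC : ℝ := (μY.map (HeisRing.mulSkewUnit (conjLocal L (IsCMField.complexConj L) v) δ hδ).symm).real
    {c : ↥(HeisRing.fixedPart (conjLocal L (IsCMField.complexConj L) v)) | Valued.v ((c : LocalRing L v) w) = 1} with hνC
  set νm : ℝ := (μY.map (HeisRing.mulSkewUnit (conjLocal L (IsCMField.complexConj L) v) δ hδ).symm).real
    {c : ↥(HeisRing.fixedPart (conjLocal L (IsCMField.complexConj L) v)) | Valued.v ((c : LocalRing L v) w) < 1} with hνm
  set E : ℂ := (((χ₁ (-δ))⁻¹ : ℂˣ) : ℂ) with hE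
  set Φdeep : ℂ := E * (νC : ℂ) with hΦdeep_def
  set Φcrit : ℂ := -(E * (νm : ℂ)) with hΦcrit_def
  -- the base family `a′ = l^t · (−xσx·c)` is `σ`-fixed
  have hfam : ∀ (t : ℕ) (x : LocalRing L v), conjLocal L (IsCMField.complexConj L) v
      ((((l ^ t : (LocalRing L v)ˣ)) : LocalRing L v) * (-(x * conjLocal L (IsCMField.complexConj L) v x) * c)) =
        (((l ^ t : (LocalRing L v)ˣ)) : LocalRing L v) * (-(x * conjLocal L (IsCMField.complexConj L) v x) * c) := by
    intro t x
    have hlt : conjLocal L (IsCMField.complexConj L) v ((((l ^ t : (LocalRing L v)ˣ)) : LocalRing L v)) = (((l ^ t : (LocalRing L v)ˣ)) : LocalRing L v) := by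
      rw [Units.val_pow_eq_pow_val, map_pow, hlσ]
    rw [map_mul, hlt, map_mul, map_neg, map_mul, conjLocal_conjLocal_cm L v, hcσ, mul_comm (conjLocal L (IsCMField.complexConj L) v x) x]
  -- the three sphere letters of ★ (6e)
  have hΦdeep : ∀ (t : ℕ) (x : LocalRing L v),
      Valued.v (((((l ^ t : (LocalRing L v)ˣ)) : LocalRing L v) * (-(x * conjLocal L (IsCMField.complexConj L) v x) * c)) w) ≤ Valued.v ϖ ^ (m + 2) →
      ∫ s in {s : ↥(HeisRing.skewPart (conjLocal L (IsCMField.complexConj L) v)) | Valued.v ((s : LocalRing L v) w) = WithZero.exp (-1 : ℤ)},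
          (fun r : LocalRing L v => if h : IsUnit r then (((χ₁ h.unit)⁻¹ : ℂˣ) : ℂ) else 0)
            ((((l ^ t : (LocalRing L v)ˣ)) : LocalRing L v) * (-(x * conjLocal L (IsCMField.complexConj L) v x) * c) - (s : LocalRing L v)) ∂μY = Φdeep :=
    fun t x hav => sphere_diteInv_sub_eq_of_fix_deep L v w hw μY χ₁ δ hδ hδv h₁ hfix hϖ htriv hav
  have hΦcrit : ∀ (t : ℕ) (x : LocalRing L v),
      Valued.v (((((l ^ t : (LocalRing L v)ˣ)) : LocalRing L v) * (-(x * conjLocal L (IsCMField.complexConj L) v x) * c)) w) = Valued.v ϖ ^ (m + 1) →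
      ∫ s in {s : ↥(HeisRing.skewPart (conjLocal L (IsCMField.complexConj L) v)) | Valued.v ((s : LocalRing L v) w) = WithZero.exp (-1 : ℤ)},
          (fun r : LocalRing L v => if h : IsUnit r then (((χ₁ h.unit)⁻¹ : ℂˣ) : ℂ) else 0)
            ((((l ^ t : (LocalRing L v)ˣ)) : LocalRing L v) * (-(x * conjLocal L (IsCMField.complexConj L) v x) * c) - (s : LocalRing L v)) ∂μY = Φcrit :=
    fun t x hav => sphere_diteInv_sub_eq_of_fix_crit L v w hw μY χ₁ δ hδ hδv he h2w h₁ hfix hϖ hm hcond u₁ hu₁ hχu₁ (hfam t x) hav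
  have hΦsh : ∀ (t : ℕ) (x : LocalRing L v),
      Valued.v ϖ ^ (m + 1) < Valued.v (((((l ^ t : (LocalRing L v)ˣ)) : LocalRing L v) * (-(x * conjLocal L (IsCMField.complexConj L) v x) * c)) w) →
      Valued.v (((((l ^ t : (LocalRing L v)ˣ)) : LocalRing L v) * (-(x * conjLocal L (IsCMField.complexConj L) v x) * c)) w) ≤ Valued.v ϖ ^ 2 →
      ∫ s in {s : ↥(HeisRing.skewPart (conjLocal L (IsCMField.complexConj L) v)) | Valued.v ((s : LocalRing L v) w) = WithZero.exp (-1 : ℤ)},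
          (fun r : LocalRing L v => if h : IsUnit r then (((χ₁ h.unit)⁻¹ : ℂˣ) : ℂ) else 0)
            ((((l ^ t : (LocalRing L v)ˣ)) : LocalRing L v) * (-(x * conjLocal L (IsCMField.complexConj L) v x) * c) - (s : LocalRing L v)) ∂μY = 0 :=
    fun t x hlo hhi => setIntegral_sphere_diteInv_sub_eq_zero_of_shallow L v w hw μY χ₁ he h2w h₁ hfixP hϖ hm hcond u₁ hu₁ hχu₁ (hfam t x) hlo hhi
  -- the three rows of ★ (B) (★ (6e))
  have hfib_hi := fibreRows_hi L v w hw μY χ₁ h₁ hfixP hϖ hm u₁ hu₁ hχu₁ l hlσ hlv hlm hcσ hcw1 Φdeep he h2w hΦdeep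
  have hfib_mid := fibreRows_mid L v w hw μY χ₁ h₁ hfixP hϖ hm u₁ hu₁ hχu₁ l hlσ hlv hlm hcσ hcw1 Φcrit he h2w hΦcrit
  have hfib_lo := fibreRows_lo L v w hw μY χ₁ h₁ hfixP hϖ hm u₁ hu₁ hχu₁ l hlσ hlv hlm hcσ hcw1 he h2w hΦsh
  refine ⟨?_, ?_⟩
  · -- EVEN SHELLS: both row values are `0`
    intro j₀ j hj₀ hj
    obtain ⟨κ, -, hshell⟩ := exists_haarScalar_setIntegral_shell_cutoff L v w hw hns χ₁ h₁ hcontr μX μY μ hc hcw (m + 1) ν _ _ hfib_hi hfib_mid hfib_lo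
    rw [hshell j (by omega), if_pos hj, if_pos hj, zero_mul, zero_mul, add_zero, mul_zero]
  · -- ODD SHELLS: ★ (a′)-1 with the (R-a) ratio
    have hratio : νC = ((Ideal.absNorm w.1.asIdeal : ℝ) - 1) * νm := measureReal_fixedUnits_eq_mul_of_ramified L v w hw μY δ hδ hδv he h2w
    have hAB : ∀ κ : ℕ, (if Even (2 * κ + 1) then (0 : ℂ) else ((χ₁ l : ℂˣ) : ℂ) ^ ((2 * κ + 1) / 2 + 1) * (((Ideal.absNorm v.asIdeal : ℝ) : ℂ)⁻¹) ^ ((2 * κ + 1) / 2) * Φdeep) +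
        (if Even (2 * κ + 1) then (0 : ℂ) else ((χ₁ l : ℂˣ) : ℂ) ^ ((2 * κ + 1) / 2 + 1) * (((Ideal.absNorm v.asIdeal : ℝ) : ℂ)⁻¹) ^ ((2 * κ + 1) / 2) * Φcrit) *
          ((Ideal.absNorm w.1.asIdeal : ℂ) - 1) = 0 := by
      intro κ
      have hodd : ¬ Even (2 * κ + 1) := Nat.not_even_iff_odd.2 ⟨κ, rfl⟩
      rw [if_neg hodd, if_neg hodd]
      have hC : ((νC : ℝ) : ℂ) = (((Ideal.absNorm w.1.asIdeal : ℂ)) - 1) * ((νm : ℝ) : ℂ) := by rw [hratio]; push_cast; ring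
      have h := sphere_fix_ratio (E := E) (Q := ((Ideal.absNorm w.1.asIdeal : ℂ))) hC (Φdeep := Φdeep) (Φcrit := Φcrit) rfl rfl
        (((χ₁ l : ℂˣ) : ℂ) ^ ((2 * κ + 1) / 2 + 1) * (((Ideal.absNorm v.asIdeal : ℝ) : ℂ)⁻¹) ^ ((2 * κ + 1) / 2))
      linear_combination h
    exact setIntegral_oddShell_cutoff_eq_zero_of_fibre_ratio L v w hw hns χ₁ h₁ hcontr μX μY μ hc hcw (m + 1) ν _ _ hfib_hi hfib_mid hfib_lo (by omega) hAB

end Summit.HodgeConjecture.HodgeConjecture.R90.S1.BposRamShellsVanishOfRecord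

end
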